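import Summits.MatrixMultiplication.MatrixMultiplication.Theses.HessianPlane
import Literature.Computability.AlgebraicComplexity.AsymptoticSpectrumDuality
import Literature.Computability.AlgebraicComplexity.QuantumFunctionals

/-!
# Birth skeleton for the crux `RegularFlatPoint` (stmt-MatrixMultiplication-18180) — line "quantum completeness at one point"

`RegularFlatPoint`: some regular point `(a,b,c)` (`P(a,b,c) ≠ 0`) has `R̃(u(a,b,c)) ≤ 3`.

Line. By Strassen duality (PROVED in tree: `strassen_duality_asymptoticRank_holds`, CVZ Prop. 1.6)
`R̃(t) = max_F F(t)` over universal spectral points. The quantum functionals `F^θ` (CVZ 2023; universal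
spectral points, proved in tree) are bounded by the dimension, `F^θ(t) ≤ 3` on the `3×3×3` format
(`stub_quantumDimBound`, from `logQuantumFunctional_le`; in fact `= 3` at every regular point by the
flat marginals `MarginalsFlat`). So the crux follows from `stub_quantumComplete`: at SOME regular
point the quantum functionals exhaust the asymptotic spectrum from above — every universal spectral
point is dominated there by some `F^θ` (the Christandl–Vrana–Zuiddam completeness question, asked at
one free tensor with flat moment data). Composition `RegularFlatPoint_of` (kernel-checked).
-/

namespace Summit.MatrixMultiplication.MatrixMultiplication.Cruxes.RegularFlatPoint.QuantumComplete

open Literature.Computability.AlgebraicComplexity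

/-- The crux, verbatim (the route decl `HessianPlane.RegularFlatPoint` unfolds to this). -/
def RegularFlatPoint : Prop :=
  ∃ a b c : ℂ, a * b * c * (a ^ 3 - b ^ 3) * (b ^ 3 - c ^ 3) * (c ^ 3 - a ^ 3) * ((a ^ 3 + b ^ 3 + c ^ 3) ^ 3 - 27 * a ^ 3 * b ^ 3 * c ^ 3) ≠ 0 ∧ Literature.Computability.AlgebraicComplexity.asymptoticRank (fun x y z : Fin 3 => if x + y + z = 0 then ![a, b, c] (y - x) else (0 : ℂ)) ≤ 3

/-- STUB 1 (the content, size XL): at some regular point the quantum functionals are spectrally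
complete from above: every universal spectral point is dominated there by a quantum functional. -/
theorem stub_quantumComplete :
    ∃ a b c : ℂ, a * b * c * (a ^ 3 - b ^ 3) * (b ^ 3 - c ^ 3) * (c ^ 3 - a ^ 3) *
        ((a ^ 3 + b ^ 3 + c ^ 3) ^ 3 - 27 * a ^ 3 * b ^ 3 * c ^ 3) ≠ 0 ∧
      ∀ F : SpectralMap ℂ, IsUniversalSpectralPoint ℂ F →
        ∃ θ : Fin 3 → ℝ, θ ∈ stdSimplex ℝ (Fin 3) ∧
          F (fun x y z : Fin 3 => if x + y + z = 0 then ![a, b, c] (y - x) else (0 : ℂ)) ≤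
            quantumFunctional θ (fun x y z : Fin 3 => if x + y + z = 0 then ![a, b, c] (y - x) else (0 : ℂ)) := by
  sorry

/-- STUB 2 (provable-now, size M): the dimension bound for quantum functionals on the `3×3×3` format,
`F^θ(t) = 2^{sup H_θ} ≤ 2^{∑ θᵢ log₂ 3} = 3` (`logQuantumFunctional_le`). -/
theorem stub_quantumDimBound :
    ∀ θ : Fin 3 → ℝ, θ ∈ stdSimplex ℝ (Fin 3) → ∀ t : Fin 3 → Fin 3 → Fin 3 → ℂ,
      quantumFunctional θ t ≤ 3 := by
  sorry

/-- COMPOSITION (kernel-checked): completeness at a regular point + the dimension bound + Strassen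
duality (proved) give `R̃ ≤ 3` there. -/
theorem RegularFlatPoint_of
    (h₁ : ∃ a b c : ℂ, a * b * c * (a ^ 3 - b ^ 3) * (b ^ 3 - c ^ 3) * (c ^ 3 - a ^ 3) *
        ((a ^ 3 + b ^ 3 + c ^ 3) ^ 3 - 27 * a ^ 3 * b ^ 3 * c ^ 3) ≠ 0 ∧
      ∀ F : SpectralMap ℂ, IsUniversalSpectralPoint ℂ F →
        ∃ θ : Fin 3 → ℝ, θ ∈ stdSimplex ℝ (Fin 3) ∧
          F (fun x y z : Fin 3 => if x + y + z = 0 then ![a, b, c] (y - x) else (0 : ℂ)) ≤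
            quantumFunctional θ (fun x y z : Fin 3 => if x + y + z = 0 then ![a, b, c] (y - x) else (0 : ℂ)))
    (h₂ : ∀ θ : Fin 3 → ℝ, θ ∈ stdSimplex ℝ (Fin 3) → ∀ t : Fin 3 → Fin 3 → Fin 3 → ℂ,
      quantumFunctional θ t ≤ 3) :
    RegularFlatPoint := by
  obtain ⟨a, b, c, hreg, hF⟩ := h₁
  refine ⟨a, b, c, hreg, ?_⟩
  refine strassen_duality_asymptoticRank.asymptoticRank_le (strassen_duality_asymptoticRank_holds ℂ) _
    fun F hUF => ?_
  obtain ⟨θ, hθ, hle⟩ := hF F hUF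
  exact hle.trans (h₂ θ hθ _)

/-- The skeleton closes the crux from its stubs. -/
theorem RegularFlatPoint_of_stubs : RegularFlatPoint :=
  RegularFlatPoint_of stub_quantumComplete stub_quantumDimBound

end Summit.MatrixMultiplication.MatrixMultiplication.Cruxes.RegularFlatPoint.QuantumComplete
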